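import Summits.Ventures.PercRepro.MSTightConjTSing
import Summits.Ventures.PercRepro.MSTightConjTCandidate
import Summits.Ventures.PercRepro.MSTightSingRemovable

/-!
# The exact remaining piece of the non-monotone Case I, as a candidate Prop

Dossier proofs/MINE1-theoremS.md, Addendum 45 (supplement 3). `SingCaseIResidue α` (never asserted)
is the count (c) of Addendum 43 in its exact form: in a residue instance `(F, u)` with `r ∈ u`, a
tight trace at `r`, `u.erase r ∈ F` (Case I), `r` neither removable nor addable, `Y ⊆ X` at `r`
and `{r}, S ∖ r ∉ F`, every `r`-free member `s` has `u.erase r ∖ s ∈ Y` — i.e. every `r`-free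
member is C*-signable, so `F ∪ {u}` is tight, against the residue hypothesis.
`singNonMonotone_of_conjT_of_residue` assembles `SingNonMonotone α` from `ConjT α` and it: with
`sing_t_of_singNonMonotone` (MSTightSingRemovable), (SING-t) at every tight-trace element of a
residue instance rests on exactly these two candidate Props.
-/

namespace PercRepro.MSTight

open Finset
open scoped FinsetFamily

variable {α : Type*} [DecidableEq α] [Fintype α]

section Candidate

variable (α)

/-- **The exact remaining piece of the non-monotone Case I, as a candidate Prop** (never asserted):
in a residue instance `(F, u)` with `r ∈ u`, a tight trace at `r`, `u.erase r ∈ F` (Case I), `r`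
neither removable nor addable and `Y ⊆ X` at `r`, every `r`-free member `s` has `u.erase r ∖ s ∈ Y`
(equivalently every `r`-free member is C*-signable, so `F ∪ {u}` is tight — against the residue
hypothesis). Census: Addendum 43 (5) (0 valid signable Case-I configurations with an A-only
member at |S'| ≤ 5). -/
def SingCaseIResidue : Prop :=
  ∀ (F : Finset (Finset α)) (u : Finset α) (r : α), Residue F u → Tight (proj r F) → r ∈ u →
    u.erase r ∈ F → ¬ partr r F ⊆ part0 r F → ¬ part0 r F ⊆ partr r F →
    diffsY r F ⊆ diffsX r F → ({r} : Finset α) ∉ F → univ.erase r ∉ F →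
    ∀ s ∈ part0 r F, u.erase r \ s ∈ diffsY r F

variable {α}

/-- **`SingNonMonotone α` from `ConjT α` and `SingCaseIResidue α`.** -/
theorem singNonMonotone_of_conjT_of_residue (hC : ConjT α) (hR : SingCaseIResidue α) :
    SingNonMonotone α := by
  intro F u r h hP hru hu1 hrem hadd
  by_contra hcon
  push Not at hcon
  obtain ⟨hr1, hr2⟩ := hcon
  have hT : diffsY r F ⊆ diffsX r F := hC F r h.hexc h.hempty h.huniv h.hcore h.hsupp hP
  obtain ⟨s, hs, hsY⟩ :=
    exists_part0_sdiff_notMem_diffsY_of_not_tight_insert h.hexc h.hu h.hnt hru hu1 hT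
  exact hsY (hR F u r h hP hru hu1 hrem hadd hT hr1 hr2 s hs)

end Candidate

end PercRepro.MSTight
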